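import Summits.ResolutionOfSingularities.ResolutionOfSingularities.Theorems.FrobeniusLadderFRationalResolutionStalkIsoNhd
import Summits.ResolutionOfSingularities.ResolutionOfSingularities.Theorems.FrobeniusLadderFRationalResolutionRegularLocusOpenImmersion
import Summits.ResolutionOfSingularities.ResolutionOfSingularities.Theorems.FrobeniusLadderFRationalResolutionResolutionRestrict
import Literature.AlgebraicGeometry.Resolution.CanonicalResolutionProofs
import HarnessLib

/-!
# Crux `FrobeniusLadder.FRationalResolution` (stmt-ResolutionOfSingularities-15317), line `redirect`,
# stub `stub_diagonalizableQuotientResolution` — LOCAL MODEL TRANSFER for isolated singularities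

Companion of `…IsolatedGlue.lean` (finite singular locus + local resolutions `hloc` ⇒ resolution)
and of the c5 lead's `local_resolution_of_toric_stalk` (`…ToricStalks.lean`), whose proof is generic
in the model: the local datum `hloc` at an isolated singular point `s ∈ X` is a property of the
`k`-algebra germ `𝒪_{X,s}` alone. Precisely:

* `hloc_of_stalk_iso_model` — let `X` be an integral `k`-scheme locally of finite type, `s ∉ Reg X`,
  and `M` an integral `k`-scheme locally of finite type (the MODEL) with a point `q` which is its
  ONLY singular point, a `k`-isomorphism of germs `e : 𝒪_{M,q} ≅ 𝒪_{X,s}` (compatible with the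
  structure maps), and a proper `ρ : Y → M`, `Y` regular, which is an isomorphism over `Reg M` with
  dense preimage. Then `s` has an open `V ∋ s` containing no other singular point of `X` and a proper
  `ρ' : Y' → V`, `Y'` regular, an isomorphism over `V ∩ Reg X` with dense preimage — the `hloc`
  datum (Zariski-local recognition `exists_isOpenImmersion_nhd_of_stalk_iso` spreads `e` to an open
  immersion `j : V → M` with `j s = q`; regular loci correspond; restrict `ρ` along `j`).

With `…IsolatedGlue.hasResolution_of_finite_singularLocus_of_local` this turns every landed family of
resolved isolated model singularities (Veronese cones `V(n,r)` in all dimensions, Segre cones, toric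
surfaces `U(r,a)`) into a resolution theorem for ALL varieties whose singular stalks are germs of
those models, over every field. Honest label: Zariski-local models only; the stub's charts are
ÉTALE, for which the transfer needs descent of the centre (`…PrimaryDescent.lean`) instead of
recognition. No definitions, no named facts, no sorry. [folklore; cite: Kollar2007, §2.2]
-/

noncomputable section

-- single-problem summit: the doubled namespace component is forced
set_option linter.dupNamespace false

open CategoryTheory AlgebraicGeometry TopologicalSpace
open Literature.AlgebraicGeometry.Resolution

namespace Summit.ResolutionOfSingularities.ResolutionOfSingularities.Theorems.FRationalResolution.LocalModelTransfer

/-- **Local model transfer for an isolated singularity.** Let `X` be an integral `k`-scheme locally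
of finite type and `s` a point (of interest: a singular one); let `M` be an integral `k`-scheme locally of finite type
with a point `q` such that `q` is the only singular point of `M`, together with a `k`-isomorphism of
germs `e : 𝒪_{M,q} ≅ 𝒪_{X,s}` and a proper `ρ : Y → M` from a regular `Y` which is an isomorphism
over `Reg M` with dense preimage. Then `s` has an open neighbourhood `V` containing no other singular
point of `X` and a proper `ρ' : Y' → V`, `Y'` regular, an isomorphism over `V ∩ Reg X` with dense
preimage. [folklore; cite: Kollar2007, §2.2] -/
theorem hloc_of_stalk_iso_model (k : Type) [Field k] (X : Scheme.{0}) [IsIntegral X]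
    (f : X ⟶ Spec (.of k)) [LocallyOfFiniteType f] (s : X)
    (M : Scheme.{0}) [IsIntegral M] (g : M ⟶ Spec (.of k)) [LocallyOfFiniteType g] (q : M)
    (hq : ∀ t : M, t ∉ Scheme.regularLocus M → t = q)
    (e : M.presheaf.stalk q ≅ X.presheaf.stalk s)
    (he : Spec.map e.hom ≫ M.fromSpecStalk q ≫ g = X.fromSpecStalk s ≫ f)
    (hres : ∃ (Y : Scheme.{0}) (ρ : Y ⟶ M), IsProper ρ ∧ Scheme.IsRegular Y ∧
      IsIso (ρ ∣_ ⟨Scheme.regularLocus M, isOpen_regularLocus_of_locallyOfFiniteType_field g⟩) ∧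
      Dense ((ρ ⁻¹ᵁ ⟨Scheme.regularLocus M, isOpen_regularLocus_of_locallyOfFiniteType_field g⟩ :
        Y.Opens) : Set Y)) :
    ∃ (V : X.Opens), s ∈ V ∧ (∀ t : X, t ∉ Scheme.regularLocus X → t ∈ V → t = s) ∧
      ∃ (Y : Scheme.{0}) (ρ : Y ⟶ V), IsProper ρ ∧ Scheme.IsRegular Y ∧
        IsIso (ρ ∣_ (V.ι ⁻¹ᵁ ⟨Scheme.regularLocus X, isOpen_regularLocus_of_locallyOfFiniteType_field f⟩)) ∧
        Dense ((ρ ⁻¹ᵁ (V.ι ⁻¹ᵁ ⟨Scheme.regularLocus X,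
          isOpen_regularLocus_of_locallyOfFiniteType_field f⟩) : Y.Opens) : Set Y) := by
  -- Zariski-local recognition: an open `U ∋ s` with an open immersion `j : U → M`, `j s = q`
  obtain ⟨U, hsU, j, hj, hjs, -⟩ := exists_isOpenImmersion_nhd_of_stalk_iso k X M f g s q e he
  haveI := hj
  have hRegM : IsOpen (Scheme.regularLocus M) := isOpen_regularLocus_of_locallyOfFiniteType_field g
  have hRegX : IsOpen (Scheme.regularLocus X) := isOpen_regularLocus_of_locallyOfFiniteType_field f
  -- the regular loci correspond under `j`
  have hpre := preimage_regularLocus_of_isOpenImmersion U j hRegX hRegM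
  -- `s` is the only singular point of `X` inside `U`
  have huniq : ∀ t : X, t ∉ Scheme.regularLocus X → t ∈ U → t = s := by
    intro t ht htU
    have hjt : j.base ⟨t, htU⟩ ∉ Scheme.regularLocus M := by
      intro hreg
      have hmem : (⟨t, htU⟩ : U) ∈ j ⁻¹ᵁ ⟨Scheme.regularLocus M, hRegM⟩ := hreg
      rw [hpre] at hmem
      exact ht hmem
    have heq : j.base ⟨t, htU⟩ = j.base ⟨s, hsU⟩ := by rw [hq _ hjt, hjs]
    exact congrArg Subtype.val (hj.base_open.injective heq)
  -- restrict the model's resolution along `j`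
  obtain ⟨Y, ρ, hρ, hY, hiso, hd⟩ := stub_offLocus_resolution_restrict M U j _ hres
  rw [hpre] at hiso hd
  exact ⟨U, hsU, huniq, Y, ρ, hρ, hY, hiso, hd⟩

/-- **The model's resolution in the required shape, from any resolution that is an isomorphism
over the regular locus**: repackaging for models given with `IsIso (ρ ∣_ W)` and dense preimage over
an open `W` that EQUALS the regular locus as a set. [folklore] -/
theorem model_resolution_of_eq (k : Type) [Field k] (M : Scheme.{0}) (g : M ⟶ Spec (.of k))
    [LocallyOfFiniteType g] (W : M.Opens) (hW : (W : Set M) = Scheme.regularLocus M)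
    (hres : ∃ (Y : Scheme.{0}) (ρ : Y ⟶ M), IsProper ρ ∧ Scheme.IsRegular Y ∧ IsIso (ρ ∣_ W) ∧
      Dense ((ρ ⁻¹ᵁ W : Y.Opens) : Set Y)) :
    ∃ (Y : Scheme.{0}) (ρ : Y ⟶ M), IsProper ρ ∧ Scheme.IsRegular Y ∧
      IsIso (ρ ∣_ ⟨Scheme.regularLocus M, isOpen_regularLocus_of_locallyOfFiniteType_field g⟩) ∧
      Dense ((ρ ⁻¹ᵁ ⟨Scheme.regularLocus M, isOpen_regularLocus_of_locallyOfFiniteType_field g⟩ :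
        Y.Opens) : Set Y) := by
  have hW' : W = ⟨Scheme.regularLocus M, isOpen_regularLocus_of_locallyOfFiniteType_field g⟩ :=
    TopologicalSpace.Opens.ext hW
  subst hW'
  exact hres

end Summit.ResolutionOfSingularities.ResolutionOfSingularities.Theorems.FRationalResolution.LocalModelTransfer

end
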